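/-
Copyright: statement-level skeleton of a published paper (lit-balaban cell, Phase-2 proof seat p25, gen 15). No proof
claims beyond what the kernel checks below.
-/
import Literature.MathematicalPhysics.QuantumFieldTheory.BalabanImbrieJaffe1984to88.BIJ88Ineq312Instance
import Literature.MathematicalPhysics.QuantumFieldTheory.BalabanImbrieJaffe1984to88.BIJ88Ineq5144Located

/-!
# `BalabanImbrieJaffe1984to88.BIJ88Ineq312InstanceLoc` — T. Bałaban, J. Imbrie, A. Jaffe, *Effective action and cluster properties of
the abelian Higgs model*, Commun. Math. Phys. **114** (1988) 257–315 [BalabanImbrieJaffe1988], (5.14.4) p. 309 *"Here H_β ⊂ H specifies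
which (d/dt)_{γ_j} have supports intersecting X_β"* and (5.14.5) p. 312 — **LOCATED TWINS OF p25 gen 12's CONSUMERS OF THE (5.14.4) LEAF**
(erratum GAPS G-C2-p36-07, p36 gen 14 / r16 ROWS-C2-part2 v2.151): gen 12's `BIJ88Expansion5143KP` §Leaf, `BIJ88Expansion5143GkBound`
§Leaf and `BIJ88Ineq312Instance.ineq312_of_ineq5144` take the typed leaf `Ineq5144` on the UNLOCATED activity `prime (g3 adj zr)`, i.e.
quantified over all pairs `(H, X)` — unsatisfiable for slot-local data with a slot-free cube (p36's kernel witness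
`BIJ88Ineq5144Located.not_ineq5144_unlocated`), so those theorems, while correct, can never be fed model data.  Here every one of them
is re-derived from the leaf on p36's LOCATED activity `locAct loc (prime (g3 adj zr))` (the pairs with every label of `H` located in `X`,
which are the only pairs (5.14.3) produces), conclusions VERBATIM: the gen-12 parents in `_of_norm5144` / `_theta` form need (5.14.4) only
at `H = ∅` (a located pair) and at `H = slotsIn loc K X` (located by definition).

statement-level skeleton of published theorems with citation tags; proofs where landed; nothing here is a claim
about the Yang–Mills mass gap

PDF held: `paper:balaban1988-cmp114-bij-abelian-higgs-effective-action` (journal page = PDF page + 256); p. 309 = PDF 53, p. 312 =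
PDF 56.

CITATION HEADER (lean-in-tree rule).  lit-balaban cell (HOME `run/shared/lean/pub/lit-balaban/`), Phase 2, seat p25 gen 15; rows
**C2.Claim@312** (members `BIJ88Expansion5143GkBound`, `BIJ88Ineq312Instance`) and C2.Eq5.14.3-5.14.4 consumers (owner r16, referee
ref-5; heads untouched).  USED BY NAME, nothing restated: p36 gen 14's `BIJ88Ineq5144Located.{locAct, locAct_empty, locAct_of_loc}`,
gen 11/12's `BIJ88Expansion5143Obs.{corner_ratio_eq_sum_prod_Gk, corner_eq_Z_mul_sum_prod_Gk}`,
`BIJ88Expansion5143KP.{isKPVolume_vacuum_of_norm5144, corner_ratio_eq_sum_prod_Gk_of_norm5144, norm_prime_g3_cpx, …_cpx}`,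
`BIJ88Expansion5143GkBound.norm_Gk_le_theta`, `BIJ88Ineq312Instance.ineq312_instance`.

## What is proved (0 `sorry`, standard axioms, no new `Prop` facts, no definitions; every theorem is the located twin of the
named gen-12 theorem, same conclusion)

* `norm_prime_g3_le_of_ineq5144_loc` (located pairs), `norm5144_of_ineq5144_loc` (`H = ∅`), `norm_prime_g3_slotsIn_le_of_ineq5144_loc`
  (`H = slotsIn loc K X`);
* `isKPVolume_vacuum_of_ineq5144_loc`; `corner_ratio_eq_sum_prod_Gk_of_ineq5144_loc`, `corner_eq_Z_mul_sum_prod_Gk_of_ineq5144_loc`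
  (the second display of p. 312 for the corner expectations); `norm_Gk_le_of_ineq5144_loc`, `norm_Gk_le_of_ineq5144_loc'` (the `G_k`
  estimate); **`ineq312_of_ineq5144_loc`** (the typed leaf `Ineq312` instantiated with every input from the located (5.14.4)).
HONEST SCOPE: exactly that of the gen-12 files (twins; the located leaf is WEAKER than the unlocated one, `ineq5144_locAct_of_unlocated`,
so each twin implies its original's conclusion under a satisfiable hypothesis); (5.14.4) itself is NOT proved here.  NOT summit
progress; NOT continuum; NOT Clay.  Imports `BIJ88Ineq312Instance` (p25 gen 12) and `BIJ88Ineq5144Located` (p36 gen 14); modifies nothing.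
-/

noncomputable section

open Finset
open Literature.Probability.LatticeModels
open Literature.MathematicalPhysics.QuantumFieldTheory.BalabanImbrieJaffe1984to88.BIJ88Clusters5134 (IsClusterFactorizing)
open Literature.MathematicalPhysics.QuantumFieldTheory.BalabanImbrieJaffe1984to88.BIJ88VirtualSupports310
open Literature.MathematicalPhysics.QuantumFieldTheory.BalabanImbrieJaffe1984to88.BIJ88Expansion5143
open Literature.MathematicalPhysics.QuantumFieldTheory.BalabanImbrieJaffe1984to88.BIJ88Expansion5143Ordered
open Literature.MathematicalPhysics.QuantumFieldTheory.BalabanImbrieJaffe1984to88.BIJ88ObservableGas312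
open Literature.MathematicalPhysics.QuantumFieldTheory.BalabanImbrieJaffe1984to88.BIJ88ClusterSupports312
open Literature.MathematicalPhysics.QuantumFieldTheory.BalabanImbrieJaffe1984to88.BIJ88SupportRegrouping312
open Literature.MathematicalPhysics.QuantumFieldTheory.BalabanImbrieJaffe1984to88.BIJ88ObservableFactorization312
open Literature.MathematicalPhysics.QuantumFieldTheory.BalabanImbrieJaffe1984to88.BIJ88Expansion5143Obs
open Literature.MathematicalPhysics.QuantumFieldTheory.BalabanImbrieJaffe1984to88.BIJ88Expansion5143KP
open Literature.MathematicalPhysics.QuantumFieldTheory.BalabanImbrieJaffe1984to88.BIJ88Expansion5143GkBound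
open Literature.MathematicalPhysics.QuantumFieldTheory.BalabanImbrieJaffe1984to88.BIJ88Ineq312Instance
open Literature.MathematicalPhysics.QuantumFieldTheory.BalabanImbrieJaffe1984to88.BIJ88Ineq5113Covering (cubeSys)
open Literature.MathematicalPhysics.QuantumFieldTheory.BalabanImbrieJaffe1984to88.BIJ88Sect5StatementsPart2 (Ineq5144)
open Literature.MathematicalPhysics.QuantumFieldTheory.BalabanImbrieJaffe1984to88.BIJ88Ineq5144Located
  (locAct locAct_empty locAct_of_loc)

namespace Literature.MathematicalPhysics.QuantumFieldTheory.BalabanImbrieJaffe1984to88.BIJ88Ineq312InstanceLoc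

section LeafA

variable {ι : Type} [DecidableEq ι] {S : Type} [DecidableEq S] {adj : ι → ι → Prop} [DecidableRel adj]
  {nbr : ι → Finset ι} {Δ : ℕ} {W : Finset ι} {loc : S → ι} {K : Finset S} {zr : Finset S → Finset ι → Finset ι → ℝ}
  {θ β' : ℝ}

/-! ## §1 The located leaf at the pairs the consumers use -/

/-- **(5.14.4) from the located leaf, on a located pair**: `‖g₃′(H, X)‖ ≤ θ^{#H + β′|X∖H|}` for the complexified activities whenever every
label of `H` is located in `X` (located twin of `BIJ88Expansion5143GkBound.norm_prime_g3_le_of_ineq5144`).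
[cite: BalabanImbrieJaffe1988, (5.14.4) p.309] -/
theorem norm_prime_g3_le_of_ineq5144_loc
    (h : Ineq5144 (cubeSys ι) (Finset S) (locAct loc (prime (g3 adj zr))) Finset.card
      (fun H (X : Finset ι) => (X \ H.image loc).card) θ β') {H : Finset S} {X : Finset ι} (hHX : ∀ j ∈ H, loc j ∈ X) :
    ‖prime (g3 adj fun K X Λ => ((zr K X Λ : ℝ) : ℂ)) H X‖ ≤ θ ^ ((H.card : ℝ) + β' * ((X \ H.image loc).card : ℝ)) := by
  rw [norm_prime_g3_cpx]
  have hX := h H X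
  dsimp only at hX
  rwa [locAct_of_loc hHX] at hX

/-- **(5.14.4) at `H_β = ∅` from the located leaf** (`(∅, X)` is located): `‖g₃′(∅, X)‖ ≤ θ^{β′#X}` — the hypothesis `h5144` of the gen-12
`_of_norm5144` parents (located twin of `BIJ88Expansion5143KP.norm5144_of_ineq5144`). [cite: BalabanImbrieJaffe1988, (5.14.4) p.309] -/
theorem norm5144_of_ineq5144_loc
    (h : Ineq5144 (cubeSys ι) (Finset S) (locAct loc (prime (g3 adj zr))) Finset.card
      (fun H (X : Finset ι) => (X \ H.image loc).card) θ β') (X : Finset ι) :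
    ‖prime (g3 adj fun K X Λ => ((zr K X Λ : ℝ) : ℂ)) ∅ X‖ ≤ θ ^ (β' * (X.card : ℝ)) := by
  have hX := norm_prime_g3_le_of_ineq5144_loc h (H := ∅) (X := X) (fun _ hj => absurd hj (notMem_empty _))
  simpa only [card_empty, Nat.cast_zero, zero_add, image_empty, sdiff_empty] using hX

/-- **(5.14.4) at `H = H(X) = slotsIn loc K X` from the located leaf** (located by definition of `slotsIn`): the observable factors of
(5.14.3). [cite: BalabanImbrieJaffe1988, (5.14.3)–(5.14.4) p.309] -/
theorem norm_prime_g3_slotsIn_le_of_ineq5144_loc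
    (h : Ineq5144 (cubeSys ι) (Finset S) (locAct loc (prime (g3 adj zr))) Finset.card
      (fun H (X : Finset ι) => (X \ H.image loc).card) θ β') (X : Finset ι) :
    ‖prime (g3 adj fun K X Λ => ((zr K X Λ : ℝ) : ℂ)) (slotsIn loc K X) X‖
      ≤ θ ^ (((slotsIn loc K X).card : ℝ) + β' * ((X \ (slotsIn loc K X).image loc).card : ℝ)) :=
  norm_prime_g3_le_of_ineq5144_loc h fun _ hj => (mem_slotsIn.1 hj).2

/-! ## §2 KP for the vacuum gas and the second display of p. 312, from the located leaf -/

/-- **KP FOR THE VACUUM GAS OF (5.14.3) FROM THE LOCATED (5.14.4)** (located twin of `BIJ88Expansion5143KP.isKPVolume_vacuum_of_ineq5144`,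
conclusion verbatim). [cite: BalabanImbrieJaffe1988, (5.14.4) p.309, p.310 (Sect. 5.14)] -/
theorem isKPVolume_vacuum_of_ineq5144_loc (hR : ∀ x y, adj x y → adj y x) (hΔ : ∀ x, (nbr x).card ≤ Δ)
    (hnbr : ∀ x y, adj x y → y ∈ nbr x) (hθ : 0 ≤ θ) (hsmall : 2 * Real.exp 1 * θ ^ β' * ((Δ : ℝ) + 1) ^ 2 ≤ 1)
    (h : Ineq5144 (cubeSys ι) (Finset S) (locAct loc (prime (g3 adj zr))) Finset.card
      (fun H (X : Finset ι) => (X \ H.image loc).card) θ β') (W : Finset ι) :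
    IsKPVolume (Ov (cvsupp adj W)) (fun X => prime (g3 adj fun K X Λ => ((zr K X Λ : ℝ) : ℂ)) ∅ X) (fun X => (X.card : ℝ))
      (polysOf W) :=
  isKPVolume_vacuum_of_norm5144 hR hΔ hnbr hθ hsmall fun X _ => norm5144_of_ineq5144_loc h X

/-- **THE SECOND DISPLAY OF p. 312 FOR THE CORNER EXPECTATIONS OF (5.14.3), FROM THE LOCATED (5.14.4)** (located twin of
`BIJ88Expansion5143KP.corner_ratio_eq_sum_prod_Gk_of_ineq5144`, conclusion verbatim): `⟨Π_{j∈K}(d/dt)_{γ_j} …⟩ / ⟨…⟩ =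
Σ_{ρ disjoint, covering the slots, each member covering a slot} Π_{X′∈ρ} G_k(X′)`.
[cite: BalabanImbrieJaffe1988, (5.14.4) p.309, p.310, p.312 (Sect. 5.14)] -/
theorem corner_ratio_eq_sum_prod_Gk_of_ineq5144_loc (hR : ∀ x y, adj x y → adj y x) (hΔ : ∀ x, (nbr x).card ≤ Δ)
    (hnbr : ∀ x y, adj x y → y ∈ nbr x) (hθ : 0 ≤ θ) (hsmall : 2 * Real.exp 1 * θ ^ β' * ((Δ : ℝ) + 1) ^ 2 ≤ 1)
    (hzK : IsClusterFactorizing adj (zr K)) (hz0 : IsClusterFactorizing adj (zr ∅)) (hloc : IsSlotLocal loc zr)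
    (hK : ∀ j ∈ K, loc j ∈ W)
    (h : Ineq5144 (cubeSys ι) (Finset S) (locAct loc (prime (g3 adj zr))) Finset.card
      (fun H (X : Finset ι) => (X \ H.image loc).card) θ β') :
    ((zr K W W : ℝ) : ℂ) / ((zr ∅ W W : ℝ) : ℂ) =
      ∑ ρ ∈ disjFamilies (asupp (isuppO (cvsupp adj W)) (itemU (cvsupp adj W) (obsPolys W loc K) (polysOf W))) with
          (Cov (locv1 loc) K ρ ∧ ∀ X' ∈ ρ, ∃ j ∈ K, locv1 loc j ⊆ X'),
        ∏ X' ∈ ρ, Gk (cvsupp adj W) (cvsupp adj W) (slotsIn loc K) (locv1 loc) K (obsPolys W loc K)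
          (fun X => prime (g3 adj fun K X Λ => ((zr K X Λ : ℝ) : ℂ)) (slotsIn loc K X) X) (Ov (cvsupp adj W))
          (fun X => prime (g3 adj fun K X Λ => ((zr K X Λ : ℝ) : ℂ)) ∅ X) (polysOf W) X' :=
  corner_ratio_eq_sum_prod_Gk (z := fun K X Λ => ((zr K X Λ : ℝ) : ℂ)) (isClusterFactorizing_cpx hzK) (isClusterFactorizing_cpx hz0)
    (isSlotLocal_cpx hloc) hK (isKPVolume_vacuum_of_ineq5144_loc hR hΔ hnbr hθ hsmall h W)

/-- the un-normalized form from the located leaf (located twin of `BIJ88Expansion5143KP.corner_eq_Z_mul_sum_prod_Gk_of_ineq5144`).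
[cite: BalabanImbrieJaffe1988, (5.14.4) p.309, p.312 (Sect. 5.14)] -/
theorem corner_eq_Z_mul_sum_prod_Gk_of_ineq5144_loc (hR : ∀ x y, adj x y → adj y x) (hΔ : ∀ x, (nbr x).card ≤ Δ)
    (hnbr : ∀ x y, adj x y → y ∈ nbr x) (hθ : 0 ≤ θ) (hsmall : 2 * Real.exp 1 * θ ^ β' * ((Δ : ℝ) + 1) ^ 2 ≤ 1)
    (hzK : IsClusterFactorizing adj (zr K)) (hz0 : IsClusterFactorizing adj (zr ∅)) (hloc : IsSlotLocal loc zr)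
    (hK : ∀ j ∈ K, loc j ∈ W)
    (h : Ineq5144 (cubeSys ι) (Finset S) (locAct loc (prime (g3 adj zr))) Finset.card
      (fun H (X : Finset ι) => (X \ H.image loc).card) θ β') :
    ((zr K W W : ℝ) : ℂ) = ((zr ∅ W W : ℝ) : ℂ) *
      ∑ ρ ∈ disjFamilies (asupp (isuppO (cvsupp adj W)) (itemU (cvsupp adj W) (obsPolys W loc K) (polysOf W))) with
          (Cov (locv1 loc) K ρ ∧ ∀ X' ∈ ρ, ∃ j ∈ K, locv1 loc j ⊆ X'),
        ∏ X' ∈ ρ, Gk (cvsupp adj W) (cvsupp adj W) (slotsIn loc K) (locv1 loc) K (obsPolys W loc K)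
          (fun X => prime (g3 adj fun K X Λ => ((zr K X Λ : ℝ) : ℂ)) (slotsIn loc K X) X) (Ov (cvsupp adj W))
          (fun X => prime (g3 adj fun K X Λ => ((zr K X Λ : ℝ) : ℂ)) ∅ X) (polysOf W) X' :=
  corner_eq_Z_mul_sum_prod_Gk (z := fun K X Λ => ((zr K X Λ : ℝ) : ℂ)) (isClusterFactorizing_cpx hzK) (isClusterFactorizing_cpx hz0)
    (isSlotLocal_cpx hloc) hK (isKPVolume_vacuum_of_ineq5144_loc hR hΔ hnbr hθ hsmall h W)

end LeafA

/-! ## §3 The `G_k` estimate and the typed leaf `Ineq312`, from the located leaf -/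

section LeafB

variable {ι : Type} [DecidableEq ι] [Fintype ι] {S : Type} [DecidableEq S] {adj : ι → ι → Prop} [DecidableRel adj]
  {nbr : ι → Finset ι} {Δ : ℕ} {W : Finset ι} {loc : S → ι} {K : Finset S} {zr : Finset S → Finset ι → Finset ι → ℝ}
  {θ β' : ℝ}

/-- **THE `G_k` ESTIMATE FOR THE GAS OF (5.14.3) FROM THE LOCATED (5.14.4)** (located twin of
`BIJ88Expansion5143GkBound.norm_Gk_le_of_ineq5144`, conclusion verbatim): `‖G_k(X′)‖ ≤ e^{2a₀#T} Σ_D (Π_{X∈D}‖g₃′(H(X), X)‖) θ^{β″#((X′∖dsupp D)∩T)}`.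
[cite: BalabanImbrieJaffe1988, (5.14.4) p.309, (5.14.5) p.312] -/
theorem norm_Gk_le_of_ineq5144_loc (hR : ∀ x y, adj x y → adj y x) (hΔ : ∀ x, (nbr x).card ≤ Δ)
    (hnbr : ∀ x y, adj x y → y ∈ nbr x) {β'' a₀ : ℝ} (hθ0 : 0 < θ) (hθ1 : θ ≤ 1) (hβ'' : 0 ≤ β'') (ha₀ : a₀ ≤ 1 / 2)
    (hsmall : 2 * ((Δ : ℝ) + 1) ^ 2 * θ ^ (β' - β'') * Real.exp a₀ ≤ a₀)
    (h : Ineq5144 (cubeSys ι) (Finset S) (locAct loc (prime (g3 adj zr))) Finset.card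
      (fun H (X : Finset ι) => (X \ H.image loc).card) θ β') (X' : Finset (ι ⊕ (Finset ι × Finset ι))) :
    ‖Gk (cvsupp adj W) (cvsupp adj W) (slotsIn loc K) (locv1 loc) K (obsPolys W loc K)
        (fun X => prime (g3 adj fun K X Λ => ((zr K X Λ : ℝ) : ℂ)) (slotsIn loc K X) X) (Ov (cvsupp adj W))
        (fun X => prime (g3 adj fun K X Λ => ((zr K X Λ : ℝ) : ℂ)) ∅ X) (polysOf W) X'‖ ≤
      Real.exp (2 * a₀ * (X'.filter fun v => v.isLeft).card) *
        ∑ D ∈ (obsPolys W loc K).powerset with ((∀ X ∈ D, ∀ X₂ ∈ D, X ≠ X₂ → Disjoint (cvsupp adj W X) (cvsupp adj W X₂)) ∧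
            D.biUnion (slotsIn loc K) = obsIn (locv1 loc) K X' ∧ dsupp (cvsupp adj W) D ⊆ X'),
          (∏ X ∈ D, ‖prime (g3 adj fun K X Λ => ((zr K X Λ : ℝ) : ℂ)) (slotsIn loc K X) X‖) *
            θ ^ (β'' * (((X' \ dsupp (cvsupp adj W) D) ∩ X'.filter fun v => v.isLeft).card : ℝ)) :=
  norm_Gk_le_theta hR hΔ hnbr hθ0 hθ1 hβ'' ha₀ hsmall (fun X _ => norm5144_of_ineq5144_loc h X) X'

/-- **… with the observable factors bounded by the located leaf too** (located twin of `BIJ88Expansion5143GkBound.norm_Gk_le_of_ineq5144'`,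
conclusion verbatim; the pairs `(slotsIn loc K X, X)` are located). [cite: BalabanImbrieJaffe1988, (5.14.4) p.309, (5.14.5) p.312] -/
theorem norm_Gk_le_of_ineq5144_loc' (hR : ∀ x y, adj x y → adj y x) (hΔ : ∀ x, (nbr x).card ≤ Δ)
    (hnbr : ∀ x y, adj x y → y ∈ nbr x) {β'' a₀ : ℝ} (hθ0 : 0 < θ) (hθ1 : θ ≤ 1) (hβ'' : 0 ≤ β'') (ha₀ : a₀ ≤ 1 / 2)
    (hsmall : 2 * ((Δ : ℝ) + 1) ^ 2 * θ ^ (β' - β'') * Real.exp a₀ ≤ a₀)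
    (h : Ineq5144 (cubeSys ι) (Finset S) (locAct loc (prime (g3 adj zr))) Finset.card
      (fun H (X : Finset ι) => (X \ H.image loc).card) θ β') (X' : Finset (ι ⊕ (Finset ι × Finset ι))) :
    ‖Gk (cvsupp adj W) (cvsupp adj W) (slotsIn loc K) (locv1 loc) K (obsPolys W loc K)
        (fun X => prime (g3 adj fun K X Λ => ((zr K X Λ : ℝ) : ℂ)) (slotsIn loc K X) X) (Ov (cvsupp adj W))
        (fun X => prime (g3 adj fun K X Λ => ((zr K X Λ : ℝ) : ℂ)) ∅ X) (polysOf W) X'‖ ≤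
      Real.exp (2 * a₀ * (X'.filter fun v => v.isLeft).card) *
        ∑ D ∈ (obsPolys W loc K).powerset with ((∀ X ∈ D, ∀ X₂ ∈ D, X ≠ X₂ → Disjoint (cvsupp adj W X) (cvsupp adj W X₂)) ∧
            D.biUnion (slotsIn loc K) = obsIn (locv1 loc) K X' ∧ dsupp (cvsupp adj W) D ⊆ X'),
          (∏ X ∈ D, θ ^ (((slotsIn loc K X).card : ℝ) + β' * ((X \ (slotsIn loc K X).image loc).card : ℝ))) *
            θ ^ (β'' * (((X' \ dsupp (cvsupp adj W) D) ∩ X'.filter fun v => v.isLeft).card : ℝ)) := by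
  refine (norm_Gk_le_of_ineq5144_loc hR hΔ hnbr hθ0 hθ1 hβ'' ha₀ hsmall h X').trans ?_
  refine mul_le_mul_of_nonneg_left (sum_le_sum fun D _ => ?_) (Real.exp_pos _).le
  refine mul_le_mul_of_nonneg_right ?_ (Real.rpow_nonneg hθ0.le _)
  exact prod_le_prod (fun _ _ => norm_nonneg _) fun X _ => norm_prime_g3_slotsIn_le_of_ineq5144_loc h X

/-- **THE TYPED LEAF `Ineq312` INSTANTIATED WITH EVERY INPUT FROM THE LOCATED (5.14.4)** (located twin of
`BIJ88Ineq312Instance.ineq312_of_ineq5144`, conclusion verbatim: `Ineq312 (cubeSys (ι ⊕ (Finset ι × Finset ι))) ‖G_k‖ cF obsProd nfree θ β″`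
with `c_j = θ`). [cite: BalabanImbrieJaffe1988, (5.14.4) p.309, (5.14.5) p.312] -/
theorem ineq312_of_ineq5144_loc (hR : ∀ x y, adj x y → adj y x) (hΔ : ∀ x, (nbr x).card ≤ Δ) (hnbr : ∀ x y, adj x y → y ∈ nbr x)
    {β'' a₀ : ℝ} (hθ0 : 0 < θ) (hθ1 : θ ≤ 1) (hβ'' : 0 ≤ β'') (hβ : β'' ≤ β') (ha₀ : a₀ ≤ 1 / 2)
    (hsmall : 2 * ((Δ : ℝ) + 1) ^ 2 * θ ^ (β' - β'') * Real.exp a₀ ≤ a₀)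
    (h : Ineq5144 (cubeSys ι) (Finset S) (locAct loc (prime (g3 adj zr))) Finset.card
      (fun H (X : Finset ι) => (X \ H.image loc).card) θ β') :
    BIJ88Sect5StatementsPart4.Ineq312 (cubeSys (ι ⊕ (Finset ι × Finset ι)))
      (fun X' : Finset (ι ⊕ (Finset ι × Finset ι)) =>
        ‖Gk (cvsupp adj W) (cvsupp adj W) (slotsIn loc K) (locv1 loc) K (obsPolys W loc K)
          (fun X => prime (g3 adj fun K X Λ => ((zr K X Λ : ℝ) : ℂ)) (slotsIn loc K X) X) (Ov (cvsupp adj W))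
          (fun X => prime (g3 adj fun K X Λ => ((zr K X Λ : ℝ) : ℂ)) ∅ X) (polysOf W) X'‖)
      (fun X' : Finset (ι ⊕ (Finset ι × Finset ι)) => Real.exp (2 * a₀ * (X'.filter fun v => v.isLeft).card) *
        (((obsPolys W loc K).powerset.filter fun D => (∀ X ∈ D, ∀ X₂ ∈ D, X ≠ X₂ → Disjoint (cvsupp adj W X) (cvsupp adj W X₂)) ∧
            D.biUnion (slotsIn loc K) = obsIn (locv1 loc) K X' ∧ dsupp (cvsupp adj W) D ⊆ X').card : ℝ))
      (fun X' : Finset (ι ⊕ (Finset ι × Finset ι)) => ∏ _j ∈ obsIn (locv1 loc) K X', θ)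
      (fun X' : Finset (ι ⊕ (Finset ι × Finset ι)) => ((X'.filter fun v => v.isLeft) \ K.image (locv loc)).card) θ β'' := by
  refine ineq312_instance hR hΔ hnbr hθ0 hθ1 hβ'' hβ ha₀ hsmall (fun X hX hc => ?_) (fun X _ => norm5144_of_ineq5144_loc h X)
    (fun _ => hθ0.le) fun X _ => ?_
  · by_contra hne
    exact hc (isRConnected_of_prime_g3_ne_zero hR _ ∅ (mem_polysOf.1 hX).2 hne)
  · rw [prod_const, ← Real.rpow_natCast, ← Real.rpow_add hθ0]
    exact norm_prime_g3_slotsIn_le_of_ineq5144_loc h X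

omit [Fintype ι] in
/-- each located twin implies its gen-12 original: the unlocated leaf gives the located one
(`BIJ88Ineq5144Located.ineq5144_locAct_of_unlocated`). [cite: BalabanImbrieJaffe1988, (5.14.4) p.309] -/
theorem ineq5144_loc_of_unlocated
    (h : Ineq5144 (cubeSys ι) (Finset S) (prime (g3 adj zr)) Finset.card (fun H (X : Finset ι) => (X \ H.image loc).card) θ β') :
    Ineq5144 (cubeSys ι) (Finset S) (locAct loc (prime (g3 adj zr))) Finset.card
      (fun H (X : Finset ι) => (X \ H.image loc).card) θ β' :=
  BIJ88Ineq5144Located.ineq5144_locAct_of_unlocated _ _ h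

end LeafB

end Literature.MathematicalPhysics.QuantumFieldTheory.BalabanImbrieJaffe1984to88.BIJ88Ineq312InstanceLoc
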